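import Mathlib
import Literature.MathematicalPhysics.QuantumFieldTheory.Balaban1983to89.B16Sect1Wilson
import Literature.MathematicalPhysics.QuantumFieldTheory.Balaban1983to89.B11SupSize190

/-!
# `Balaban1983to89.B16Ineq16From190` — [Balaban1989LargeFieldII] (1.6) p. 357, FIRST inequality «the expression on the
# right-hand side above can be bounded by g_k⁻¹B₃M₀A₀p₀(g_k)exp(−δ dist(Ω_k,Λ))3ε_k|Λ|» DERIVED FROM [15] (190): the typed leaf
# `B16Sect1Wilson.Ineq16` (row B16.Eq1.6) from the (190) record IN ITS KERNEL (ℓ¹) FORM summed over the output blocks, one (2.61)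
# row sum, the localisation of `B′` in `Λ` and of `1 − ζ₀` away from `Λ`, the printed sizes `|B′| < M₀A₀p₀(g_k)` ((1.101) [IV])
# and `|(1−ζ₀)η⁻²Im ∂U₀| ≤ 3ε_k` ((1.80) [IV] regularity), the dictionary `ε_k = g_kA₀p₀(g_k)` ((2.2) [III]) and `|Λ| ≤ (100M)⁴`

statement-level skeleton of published theorems with citation tags; proofs where landed; nothing here is a claim about
the Yang–Mills mass gap.

CITATION HEADER (lean-in-tree rule 2026-08-18).  T. Bałaban, *Large field renormalization. II. Localization, exponentiation, and
bounds for the 𝐑 operation*, Commun. Math. Phys. **122**, 355–392 (1989), doi:10.1007/BF01238433, bib `Balaban1989LargeFieldII` (cell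
paper B16; PDF held `paper:balaban1989-cmp122-large-field-ii`, journal page = PDF page + 354; p. 357 = PDF 3 READ by this seat from the
held text layer, `lit read … --pages 1-6`, 2026-08-25).  "[15]" = [Balaban1985Variational] (190) p. 308 (`B11SectG.Ineq190`); "[11]" =
[Balaban1984PropagatorsII] Lemma 2.1 (2.61) p. 234 (`B11SectG.RowSum`); "[IV]" = [Balaban1989LargeFieldI] ((1.80) p. 194, (1.101) p. 201);
"[III]" = [Balaban1988Convergent] ((2.2) p. 255).  WHAT IS REPRODUCED: SKELETON row **B16.Eq1.6** (owner r13, leaf `B16Sect1Wilson.Ineq16`,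
head «typed p238829 (leaf)»; its arithmetic `B16Sect1Wilson.ineq16_arith`, its smallness `B16Sect1SmallFactors.ineq16_rhs_small` and its box
count `B16Sect1BoxCounts.ineq16_mid_le_of_box` are the tree theorems so far).  Unit `pub-ymgap-dag-n13-b` (HUMAN RULING D-0062, Track A,
node N13 = [B16], -b FIRST-MISSING-ESTIMATE seat), HOME `run/shared/lean/pub/pub-ymgap/`.

THE PRINTED TEXT (p. 357 [PDF 3]).  After (1.5) *«−g_k⁻¹⟨D𝐇_{1,k}B′, ζ₀η⁻²Im ∂U₀⟩ = −g_k⁻¹⟨D𝐇_{1,k}B′, (1 − ζ₀)η⁻²Im ∂U₀⟩»*: *«By the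
exponential decay of the minimizer, and the localizations of 1 − ζ₀ and B′, the expression on the right-hand side above can be bounded
by g_k⁻¹B₃M₀A₀p₀(g_k)exp(−δ dist(Ω_k, Λ))3ε_k|Λ| < 3B₃M₀A₀²p₀²(g_k)exp(−R_k)(100M)⁴, (1.6) where we have used the fact that Λ is contained
in a cube of the size 100M. The bound on the right-hand side above can be made arbitrarily small for sufficiently small g_k, but it is
enough to have an absolute bound, e.g., the number 1.»*  The second «<» is r13's `ineq16_arith`; THIS FILE proves the first «≦».

THE MECHANISM.  (190) of [15] in the tree's block-majorant form (`B11SectG.Ineq190 bB bout T C δ₀` = `HasMaj` with the kernel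
`C·e^{−⅛δ₀d(y,y′)}`) bounds, through the partition of unity of the source space (`B11SectG.HasMaj.bound`), the size of `T B′` at EVERY
output block `y` by the ℓ¹ expression `Σ_{y′} C e^{−⅛δ₀d(y,y′)}·κ_B·loc_{y′}B′`.  SUMMING OVER THE OUTPUT BLOCKS `y ∈ S` (the blocks
carrying `1 − ζ₀`) and exchanging the sums puts the count on the INPUT side: with `B′` of B-size `≤ m` carried by the blocks `Λb` of `Λ`
(`loc_{y′}B′ = 0` off `Λb`), `d(y,y′) ≥ D` for `y ∈ S`, `y′ ∈ Λb`, one row sum (2.61) at rate `σ` (symmetric distance) and `σ + τ ≤ ⅛δ₀`,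
`Σ_{y∈S} loc_y(T B′) ≤ C κ_B c · m · e^{−τD} · #Λb` (`sum_loc_le_card_mul`) — print's factor `|Λ|` is `#Λb`, the number of unit blocks
of `Λ`.  The pairing `⟨f, q⟩ = Σ_p w_p⟪f(p), q(p)⟫` of a plaquette field `f` with the FIXED field `q = (1 − ζ₀)η⁻²Im ∂U₀`
(`|q(p)| ≤ 3ε_k`, `q = 0` off the blocks of `S`, weights `w_p ≥ 0` with `Σ_{p ∈ block} w_p ≤ ω`) is at most `3ε_k·ω·Σ_{y∈S} loc_y f` for
the sup size `B11SupSize190.supSize` (`abs_pairing_le`).  With `T B′ = D𝐇_{1,k}B′`, `ε_k = g_kA₀p₀(g_k)`, `m < M₀A₀p₀(g_k)` (the χ of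
(1.2): `|g_kB′| = |(1/i)log V′| < M₀ε_k`, (1.101) [IV]), `R_k ≤ τD` and `#Λb ≤ (100M)⁴` this is `Ineq16` AS TYPED for the linear term
`g_k⁻¹⟨D𝐇_{1,k}B′, (1 − ζ₀)η⁻²Im ∂U₀⟩` (`ineq16_of_ineq190`), and its printed middle expression is `pairing16_le_middle`.

WHAT THIS FILE PROVES (kernel-checked, zero `sorry`, theorems only — no definition, no named fact; axioms standard; BY NAME:
`B11SectG.HasMaj.bound`, `B11SectG.Ineq190`, `B11SectG.RowSum`, `B11SupSize190.supSize` / `norm_apply_le_loc`, `B16Sect1Wilson.Ineq16`).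
§1 `sum_loc_le_card_mul` — the ℓ¹ form of (190) summed over a set of output blocks (abstract `BlockNorm` carriers).
§2 `abs_pairing_le` — the weighted pairing of a plaquette field with a fixed bounded field localised on the blocks of `S` is dominated by
   the sum of the sup sizes over `S` (concrete carrier `Pl → V`, `V` a real inner-product space: 𝔤 with `−tr`, or `ℝ`).
§3 `pairing16_le_middle` — the FIRST «≦» of (1.6) with print's letters: `|g_k⁻¹⟨T B′, q⟩| ≤ g_k⁻¹·B₃·M₀A₀p₀(g_k)·e^{−τD}·3ε_k·#Λb`;
   `ineq16_of_ineq190` — `B16Sect1Wilson.Ineq16 (g_k⁻¹⟨T B′, q⟩) B₃ M₀ A₀ p₀g R_k M` AS TYPED.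
HONEST SCOPE.  Hypotheses, in their printed shapes: (190) itself for the linear map `B′ ↦ D𝐇_{1,k}B′` into the plaquette sup size (row
B11.Eq190; *«the exponential decay of the minimizer»*), one row sum (2.61) with a symmetric block distance, the localisation letters
(`B′` carried by the blocks `Λb`, `q` by the blocks `S`, `D ≤ d(S, Λb)`, `R_k ≤ τD` = print's `exp(−δ dist(Ω_k,Λ)) ≤ exp(−R_k)`), the
sizes `m < M₀A₀p₀(g_k)` and `|q| ≤ 3ε_k`, the count `#Λb ≤ (100M)⁴` (*«Λ is contained in a cube of the size 100M»*; on the `Setup` torus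
this is `B16Sect1BoxCounts.volΛ_le_of_box`), and ONE located weight letter `ω·(C·κ_B·c) ≤ B₃` — the same species as the accepted
weight letters `L^jη·C₀κ_Bc ≤ B₃` of `B16Ineq123From190` (p29): print writes the single constant `B₃` where the derivation produces
(190)'s constant × the (2.61) row sum × the per-block pairing weight `ω` (= the number of plaquettes of a unit block × η^d); the B16 fold
owner records that (1.6) *«has no O(1) in print»* (`lit-balaban-r13/B16-CLOSURE.md` §3.5) — this file does not invent one, it
names the product print calls `B₃`.  Nothing about `U₀`, `𝐇_{1,k}`, `ζ₀` beyond these letters is used.  NOT summit progress.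
-/

namespace Literature.MathematicalPhysics.QuantumFieldTheory.Balaban1983to89.B16Ineq16From190

open Literature.MathematicalPhysics.QuantumFieldTheory.Balaban1983to89
open B11SectG B11SupSize190 B16Sect1Wilson
open scoped RealInnerProductSpace

/-! ## §1. The ℓ¹ form of (190), summed over a set of output blocks -/

section Abstract

variable {g : B6.Geometry} {FB FA : Type} [AddCommGroup FB] [Module ℝ FB] [AddCommGroup FA] [Module ℝ FA]

/-- **(190) summed over the output blocks** — the step *«By the exponential decay of the minimizer, and the localizations of 1 − ζ₀
and B′»* of p. 357 in kernel form: if `T` has the (190) majorant `C e^{−⅛δ₀d(y,y′)}` from the B-size `bB` to the size `bout`, the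
input `B` has B-size `≤ m` and is carried by the blocks `Λb` (`loc_{y′} B = 0` for `y′ ∉ Λb`), every block of `S` is at distance `≥ D`
from every block of `Λb`, the distance is symmetric and (2.61) holds at rate `σ` with `σ + τ ≤ ⅛δ₀`, `τ ≥ 0`, then
`Σ_{y∈S} loc_y(T B) ≤ C κ_B c · m · e^{−τD} · #Λb` — the count falls on the INPUT side (print's `|Λ|`).
[cite: Balaban1989LargeFieldII, (1.6) p.357; Balaban1985Variational, (190) p.308; Balaban1984PropagatorsII, Lemma 2.1 (2.61) p.234] -/
theorem sum_loc_le_card_mul {bB : BlockNorm g FB} {bout : BlockNorm g FA} {T : FB →ₗ[ℝ] FA}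
    {C δ₀ σ τ c m D : ℝ} (h190 : Ineq190 bB bout T C δ₀) (hC : 0 ≤ C)
    (hd : ∀ a b : g.Site, 0 ≤ g.dist a b) (hsymm : ∀ a b : g.Site, g.dist a b = g.dist b a)
    (hrow : RowSum g σ c) (hτ : 0 ≤ τ) (hστ : σ + τ ≤ δ₀ / 8)
    (B : FB) (Λb S : Finset g.Site) (hm : ∀ y', bB.loc y' B ≤ m) (hsupp : ∀ y', y' ∉ Λb → bB.loc y' B = 0)
    (hD : ∀ y ∈ S, ∀ y' ∈ Λb, D ≤ g.dist y y') :
    ∑ y ∈ S, bout.loc y (T B) ≤ C * bB.κ * c * m * Real.exp (-(τ * D)) * Λb.card := by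
  classical
  have hK : ∀ a b : g.Site, 0 ≤ C * Real.exp (-(δ₀ / 8 * g.dist a b)) :=
    fun a b => mul_nonneg hC (Real.exp_nonneg _)
  -- (190) in kernel form at every output block, then exchange the two sums
  have h1 : ∑ y ∈ S, bout.loc y (T B) ≤
      ∑ y ∈ S, ∑ y' : g.Site, C * Real.exp (-(δ₀ / 8 * g.dist y y')) * (bB.κ * bB.loc y' B) :=
    Finset.sum_le_sum fun y _ => HasMaj.bound h190 hK B y
  rw [Finset.sum_comm] at h1
  -- the column of one input block `y′`
  have hcol : ∀ y' : g.Site, ∑ y ∈ S, C * Real.exp (-(δ₀ / 8 * g.dist y y')) * (bB.κ * bB.loc y' B) ≤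
      if y' ∈ Λb then C * bB.κ * c * m * Real.exp (-(τ * D)) else 0 := by
    intro y'
    by_cases hy' : y' ∈ Λb
    · rw [if_pos hy']
      have hκloc : 0 ≤ bB.κ * bB.loc y' B := mul_nonneg bB.κ_nonneg (bB.loc_nonneg _ _)
      have hterm : ∀ y ∈ S, C * Real.exp (-(δ₀ / 8 * g.dist y y')) * (bB.κ * bB.loc y' B) ≤
          C * Real.exp (-(τ * D)) * (bB.κ * m) * Real.exp (-(σ * g.dist y' y)) := by
        intro y hy
        have hDd : D ≤ g.dist y y' := hD y hy y' hy'
        have he : Real.exp (-(δ₀ / 8 * g.dist y y')) ≤ Real.exp (-(τ * D)) * Real.exp (-(σ * g.dist y' y)) := by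
          rw [← Real.exp_add, hsymm y' y]
          refine Real.exp_le_exp.mpr ?_
          have h3 : τ * D ≤ τ * g.dist y y' := mul_le_mul_of_nonneg_left hDd hτ
          have h4 : (σ + τ) * g.dist y y' ≤ δ₀ / 8 * g.dist y y' := mul_le_mul_of_nonneg_right hστ (hd y y')
          nlinarith
        calc C * Real.exp (-(δ₀ / 8 * g.dist y y')) * (bB.κ * bB.loc y' B)
            ≤ C * (Real.exp (-(τ * D)) * Real.exp (-(σ * g.dist y' y))) * (bB.κ * bB.loc y' B) :=
              mul_le_mul_of_nonneg_right (mul_le_mul_of_nonneg_left he hC) hκloc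
          _ ≤ C * (Real.exp (-(τ * D)) * Real.exp (-(σ * g.dist y' y))) * (bB.κ * m) :=
              mul_le_mul_of_nonneg_left (mul_le_mul_of_nonneg_left (hm y') bB.κ_nonneg)
                (mul_nonneg hC (mul_nonneg (Real.exp_nonneg _) (Real.exp_nonneg _)))
          _ = C * Real.exp (-(τ * D)) * (bB.κ * m) * Real.exp (-(σ * g.dist y' y)) := by ring
      have hm0 : 0 ≤ m := (bB.loc_nonneg y' B).trans (hm y')
      have hpre : 0 ≤ C * Real.exp (-(τ * D)) * (bB.κ * m) :=
        mul_nonneg (mul_nonneg hC (Real.exp_nonneg _)) (mul_nonneg bB.κ_nonneg hm0)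
      calc ∑ y ∈ S, C * Real.exp (-(δ₀ / 8 * g.dist y y')) * (bB.κ * bB.loc y' B)
          ≤ ∑ y ∈ S, C * Real.exp (-(τ * D)) * (bB.κ * m) * Real.exp (-(σ * g.dist y' y)) :=
            Finset.sum_le_sum hterm
        _ = C * Real.exp (-(τ * D)) * (bB.κ * m) * ∑ y ∈ S, Real.exp (-(σ * g.dist y' y)) := by
            rw [Finset.mul_sum]
        _ ≤ C * Real.exp (-(τ * D)) * (bB.κ * m) * ∑ y : g.Site, Real.exp (-(σ * g.dist y' y)) :=
            mul_le_mul_of_nonneg_left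
              (Finset.sum_le_univ_sum_of_nonneg fun y => (Real.exp_nonneg _)) hpre
        _ ≤ C * Real.exp (-(τ * D)) * (bB.κ * m) * c := mul_le_mul_of_nonneg_left (hrow y') hpre
        _ = C * bB.κ * c * m * Real.exp (-(τ * D)) := by ring
    · rw [if_neg hy']
      refine Finset.sum_nonpos fun y _ => ?_
      rw [hsupp y' hy', mul_zero, mul_zero]
  calc ∑ y ∈ S, bout.loc y (T B)
      ≤ ∑ y' : g.Site, ∑ y ∈ S, C * Real.exp (-(δ₀ / 8 * g.dist y y')) * (bB.κ * bB.loc y' B) := h1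
    _ ≤ ∑ y' : g.Site, (if y' ∈ Λb then C * bB.κ * c * m * Real.exp (-(τ * D)) else 0) :=
        Finset.sum_le_sum fun y' _ => hcol y'
    _ = ∑ y' ∈ Λb, C * bB.κ * c * m * Real.exp (-(τ * D)) := by
        rw [← Finset.sum_filter]; congr 1; ext y'; simp
    _ = C * bB.κ * c * m * Real.exp (-(τ * D)) * Λb.card := by
        rw [Finset.sum_const, nsmul_eq_mul, mul_comm]

end Abstract

/-! ## §2. The pairing with a fixed localised field on the plaquette carrier -/

section Pairing

variable {g : B6.Geometry} [DecidableEq g.Site] {Pl : Type} [Fintype Pl] {V : Type} [NormedAddCommGroup V]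
  [InnerProductSpace ℝ V]
variable {box : g.Site → Finset Pl} {blk : Pl → g.Site}

/-- The weighted pairing `⟨f, q⟩ = Σ_p w_p⟪f(p), q(p)⟫` (Bałaban's `⟨·,·⟩ = Σ_p η^d tr(· ·)` on plaquette fields, p. 357) with a FIXED
field `q` localised on the blocks of `S` (`q(p) = 0` unless the block of `p` lies in `S`) and bounded by `G`, weights `w_p ≥ 0` with
`Σ_{p ∈ block y} w_p ≤ ω`, every plaquette lying in the box of its block: `|⟨f, q⟩| ≤ G·ω·Σ_{y∈S} loc_y f` for the sup size of (190)
(`B11SupSize190.supSize`).  Cauchy–Schwarz plaquette by plaquette, then the blocks. [cite: Balaban1989LargeFieldII, (1.5)–(1.6) p.357] -/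
theorem abs_pairing_le (hbox : ∀ p : Pl, p ∈ box (blk p)) (w : Pl → ℝ) (hw : ∀ p, 0 ≤ w p) {ω : ℝ}
    (hω : ∀ y : g.Site, ∑ p ∈ Finset.univ.filter (fun p => blk p = y), w p ≤ ω)
    (S : Finset g.Site) (q : Pl → V) {G : ℝ} (hG0 : 0 ≤ G) (hqG : ∀ p, ‖q p‖ ≤ G)
    (hqS : ∀ p, blk p ∉ S → q p = 0) (f : Pl → V) :
    |∑ p, w p * ⟪f p, q p⟫| ≤
      G * ω * ∑ y ∈ S, (supSize g box blk : BlockNorm g (Pl → V)).loc y f := by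
  classical
  -- plaquette by plaquette: |w⟪f,q⟫| ≤ w·loc_{blk p} f·G·[blk p ∈ S]
  have hp : ∀ p : Pl, |w p * ⟪f p, q p⟫| ≤
      w p * ((supSize g box blk : BlockNorm g (Pl → V)).loc (blk p) f * (if blk p ∈ S then G else 0)) := by
    intro p
    rw [abs_mul, abs_of_nonneg (hw p)]
    refine mul_le_mul_of_nonneg_left ?_ (hw p)
    by_cases hS : blk p ∈ S
    · rw [if_pos hS]
      calc |⟪f p, q p⟫| ≤ ‖f p‖ * ‖q p‖ := abs_real_inner_le_norm _ _
        _ ≤ (supSize g box blk : BlockNorm g (Pl → V)).loc (blk p) f * G :=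
            mul_le_mul (norm_apply_le_loc (hbox p) f) (hqG p) (norm_nonneg _)
              ((supSize g box blk : BlockNorm g (Pl → V)).loc_nonneg _ _)
    · rw [if_neg hS, hqS p hS, inner_zero_right, abs_zero, mul_zero]
  -- sum, and regroup by blocks
  have hsum : |∑ p, w p * ⟪f p, q p⟫| ≤
      ∑ p, w p * ((supSize g box blk : BlockNorm g (Pl → V)).loc (blk p) f * (if blk p ∈ S then G else 0)) :=
    (Finset.abs_sum_le_sum_abs _ _).trans (Finset.sum_le_sum fun p _ => hp p)
  have hfib : ∑ p, w p * ((supSize g box blk : BlockNorm g (Pl → V)).loc (blk p) f * (if blk p ∈ S then G else 0)) =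
      ∑ y : g.Site, ∑ p ∈ Finset.univ.filter (fun p => blk p = y),
        w p * ((supSize g box blk : BlockNorm g (Pl → V)).loc y f * (if y ∈ S then G else 0)) := by
    rw [← Finset.sum_fiberwise Finset.univ blk]
    refine Finset.sum_congr rfl fun y _ => Finset.sum_congr rfl fun p hp' => ?_
    rw [(Finset.mem_filter.mp hp').2]
  rw [hfib] at hsum
  refine hsum.trans ?_
  have hblk : ∀ y : g.Site, ∑ p ∈ Finset.univ.filter (fun p => blk p = y),
      w p * ((supSize g box blk : BlockNorm g (Pl → V)).loc y f * (if y ∈ S then G else 0)) ≤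
      if y ∈ S then G * ω * (supSize g box blk : BlockNorm g (Pl → V)).loc y f else 0 := by
    intro y
    rw [← Finset.sum_mul]
    have hloc : 0 ≤ (supSize g box blk : BlockNorm g (Pl → V)).loc y f :=
      (supSize g box blk : BlockNorm g (Pl → V)).loc_nonneg _ _
    by_cases hS : y ∈ S
    · rw [if_pos hS, if_pos hS]
      calc (∑ p ∈ Finset.univ.filter (fun p => blk p = y), w p) *
            ((supSize g box blk : BlockNorm g (Pl → V)).loc y f * G)
          ≤ ω * ((supSize g box blk : BlockNorm g (Pl → V)).loc y f * G) :=
            mul_le_mul_of_nonneg_right (hω y) (mul_nonneg hloc hG0)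
        _ = G * ω * (supSize g box blk : BlockNorm g (Pl → V)).loc y f := by ring
    · rw [if_neg hS, if_neg hS, mul_zero, mul_zero]
  calc ∑ y : g.Site, ∑ p ∈ Finset.univ.filter (fun p => blk p = y),
        w p * ((supSize g box blk : BlockNorm g (Pl → V)).loc y f * (if y ∈ S then G else 0))
      ≤ ∑ y : g.Site, (if y ∈ S then G * ω * (supSize g box blk : BlockNorm g (Pl → V)).loc y f else 0) :=
        Finset.sum_le_sum fun y _ => hblk y
    _ = ∑ y ∈ S, G * ω * (supSize g box blk : BlockNorm g (Pl → V)).loc y f := by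
        rw [← Finset.sum_filter]; congr 1; ext y; simp
    _ = G * ω * ∑ y ∈ S, (supSize g box blk : BlockNorm g (Pl → V)).loc y f := by rw [Finset.mul_sum]

end Pairing

/-! ## §3. (1.6), first inequality, from (190) -/

section Ineq16

variable {g : B6.Geometry} [DecidableEq g.Site] {FB : Type} [AddCommGroup FB] [Module ℝ FB]
variable {Pl : Type} [Fintype Pl] {V : Type} [NormedAddCommGroup V] [InnerProductSpace ℝ V]
variable {box : g.Site → Finset Pl} {blk : Pl → g.Site}

/-- **(1.6) p. 357, the first «≦», with the B-size `m` of `B′` kept**: for the linear map `T : B′ ↦ D𝐇_{1,k}B′` with the (190)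
majorant into the plaquette sup size (*«the exponential decay of the minimizer»*), `B′` carried by the blocks `Λb` of `Λ` with B-size
`≤ m`, the fixed field `q = (1 − ζ₀)η⁻²Im ∂U₀` carried by the blocks `S` with `|q| ≤ 3ε_k` ((1.80) [IV] on the support of `1 − ζ₀`),
`D ≤ d(S, Λb)` (*«the localizations of 1 − ζ₀ and B′»*), one row sum (2.61), and the located weight letter `ω·(Cκ_Bc) ≤ B₃`:
`|g_k⁻¹⟨T B′, q⟩| ≤ g_k⁻¹·B₃·m·e^{−τD}·3ε_k·#Λb`. [cite: Balaban1989LargeFieldII, (1.6) p.357; Balaban1985Variational, (190) p.308] -/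
theorem pairing16_le {bB : BlockNorm g FB} {T : FB →ₗ[ℝ] (Pl → V)} {C δ₀ σ τ c m D ω B₃ εk gk : ℝ}
    (h190 : Ineq190 bB (supSize g box blk : BlockNorm g (Pl → V)) T C δ₀) (hC : 0 ≤ C)
    (hd : ∀ a b : g.Site, 0 ≤ g.dist a b) (hsymm : ∀ a b : g.Site, g.dist a b = g.dist b a)
    (hrow : RowSum g σ c) (hτ : 0 ≤ τ) (hστ : σ + τ ≤ δ₀ / 8)
    (B' : FB) (Λb S : Finset g.Site) (hm : ∀ y', bB.loc y' B' ≤ m)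
    (hsupp : ∀ y', y' ∉ Λb → bB.loc y' B' = 0) (hD : ∀ y ∈ S, ∀ y' ∈ Λb, D ≤ g.dist y y')
    (hbox : ∀ p : Pl, p ∈ box (blk p)) (w : Pl → ℝ) (hw : ∀ p, 0 ≤ w p) (hω0 : 0 ≤ ω)
    (hω : ∀ y : g.Site, ∑ p ∈ Finset.univ.filter (fun p => blk p = y), w p ≤ ω)
    (q : Pl → V) (hεk : 0 ≤ εk) (hqG : ∀ p, ‖q p‖ ≤ 3 * εk) (hqS : ∀ p, blk p ∉ S → q p = 0)
    (hCB : ω * (C * bB.κ * c) ≤ B₃) (hgk : 0 < gk) :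
    |1 / gk * ∑ p, w p * ⟪T B' p, q p⟫| ≤ 1 / gk * B₃ * m * Real.exp (-(τ * D)) * (3 * εk) * Λb.card := by
  have hpair := abs_pairing_le (g := g) hbox w hw hω S q (by positivity) hqG hqS (T B')
  have hsum := sum_loc_le_card_mul h190 hC hd hsymm hrow hτ hστ B' Λb S hm hsupp hD
  have hgk' : 0 ≤ 1 / gk := by positivity
  have h1 : |∑ p, w p * ⟪T B' p, q p⟫| ≤
      (ω * (C * bB.κ * c)) * m * (Real.exp (-(τ * D)) * ((3 * εk) * Λb.card)) := by
    calc |∑ p, w p * ⟪T B' p, q p⟫|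
        ≤ 3 * εk * ω * ∑ y ∈ S, (supSize g box blk : BlockNorm g (Pl → V)).loc y (T B') := hpair
      _ ≤ 3 * εk * ω * (C * bB.κ * c * m * Real.exp (-(τ * D)) * Λb.card) :=
          mul_le_mul_of_nonneg_left hsum (by positivity)
      _ = (ω * (C * bB.κ * c)) * m * (Real.exp (-(τ * D)) * ((3 * εk) * Λb.card)) := by ring
  rw [abs_mul, abs_of_nonneg hgk']
  rcases Λb.eq_empty_or_nonempty with hΛ | ⟨y₀, -⟩
  · -- no block carries `B′`: both sides vanish
    subst hΛ
    have h0 : |∑ p, w p * ⟪T B' p, q p⟫| ≤ 0 := by simpa using h1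
    have hl : 1 / gk * |∑ p, w p * ⟪T B' p, q p⟫| ≤ 0 := by
      have := mul_le_mul_of_nonneg_left h0 hgk'; rwa [mul_zero] at this
    have hr : (0 : ℝ) ≤ 1 / gk * B₃ * m * Real.exp (-(τ * D)) * (3 * εk) * ((∅ : Finset g.Site).card : ℕ) := by
      simp
    exact hl.trans hr
  · -- a block exists: `0 ≤ m`, `0 ≤ c`, hence `ω(Cκ_Bc)·m ≤ B₃·m`
    have hm0 : 0 ≤ m := (bB.loc_nonneg y₀ B').trans (hm y₀)
    have hrest : 0 ≤ Real.exp (-(τ * D)) * ((3 * εk) * Λb.card) := by positivity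
    have h2 : (ω * (C * bB.κ * c)) * m * (Real.exp (-(τ * D)) * ((3 * εk) * Λb.card)) ≤
        B₃ * m * (Real.exp (-(τ * D)) * ((3 * εk) * Λb.card)) :=
      mul_le_mul_of_nonneg_right (mul_le_mul_of_nonneg_right hCB hm0) hrest
    calc 1 / gk * |∑ p, w p * ⟪T B' p, q p⟫|
        ≤ 1 / gk * ((ω * (C * bB.κ * c)) * m * (Real.exp (-(τ * D)) * ((3 * εk) * Λb.card))) :=
          mul_le_mul_of_nonneg_left h1 hgk'
      _ ≤ 1 / gk * (B₃ * m * (Real.exp (-(τ * D)) * ((3 * εk) * Λb.card))) :=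
          mul_le_mul_of_nonneg_left h2 hgk'
      _ = 1 / gk * B₃ * m * Real.exp (-(τ * D)) * (3 * εk) * Λb.card := by ring

/-- **(1.6) p. 357, the first «≦», with print's letters** — *«can be bounded by g_k⁻¹B₃M₀A₀p₀(g_k)exp(−δ dist(Ω_k,Λ))3ε_k|Λ|»*: as
`pairing16_le` with the B-size of `B′` at most the χ-radius of (1.2), `m ≤ M₀A₀p₀(g_k)` ((1.101) [IV]: `|g_kB′| < M₀ε_k`, `ε_k =
g_kA₀p₀(g_k)`), and print's `B₃ ≥ 0`: `|g_k⁻¹⟨T B′, q⟩| ≤ g_k⁻¹·B₃·M₀A₀p₀(g_k)·e^{−τD}·3ε_k·#Λb` (print: `e^{−δ dist(Ω_k,Λ)}`, `|Λ|`).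
[cite: Balaban1989LargeFieldII, (1.6) p.357; Balaban1985Variational, (190) p.308; Balaban1989LargeFieldI, (1.101) p.201] -/
theorem pairing16_le_middle {bB : BlockNorm g FB} {T : FB →ₗ[ℝ] (Pl → V)} {C δ₀ σ τ c m D ω B₃ M₀ A₀ p₀g εk gk : ℝ}
    (h190 : Ineq190 bB (supSize g box blk : BlockNorm g (Pl → V)) T C δ₀) (hC : 0 ≤ C)
    (hd : ∀ a b : g.Site, 0 ≤ g.dist a b) (hsymm : ∀ a b : g.Site, g.dist a b = g.dist b a)
    (hrow : RowSum g σ c) (hτ : 0 ≤ τ) (hστ : σ + τ ≤ δ₀ / 8)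
    (B' : FB) (Λb S : Finset g.Site) (hm : ∀ y', bB.loc y' B' ≤ m) (hmle : m ≤ M₀ * A₀ * p₀g)
    (hsupp : ∀ y', y' ∉ Λb → bB.loc y' B' = 0) (hD : ∀ y ∈ S, ∀ y' ∈ Λb, D ≤ g.dist y y')
    (hbox : ∀ p : Pl, p ∈ box (blk p)) (w : Pl → ℝ) (hw : ∀ p, 0 ≤ w p) (hω0 : 0 ≤ ω)
    (hω : ∀ y : g.Site, ∑ p ∈ Finset.univ.filter (fun p => blk p = y), w p ≤ ω)
    (q : Pl → V) (hεk : 0 ≤ εk) (hqG : ∀ p, ‖q p‖ ≤ 3 * εk) (hqS : ∀ p, blk p ∉ S → q p = 0)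
    (hCB : ω * (C * bB.κ * c) ≤ B₃) (hB₃ : 0 ≤ B₃) (hgk : 0 < gk) :
    |1 / gk * ∑ p, w p * ⟪T B' p, q p⟫| ≤
      1 / gk * B₃ * (M₀ * A₀ * p₀g) * Real.exp (-(τ * D)) * (3 * εk) * Λb.card := by
  have h := pairing16_le h190 hC hd hsymm hrow hτ hστ B' Λb S hm hsupp hD hbox w hw hω0 hω q hεk hqG hqS hCB hgk
  refine h.trans ?_
  have hpre : 0 ≤ 1 / gk * B₃ := by positivity
  have hrest : 0 ≤ Real.exp (-(τ * D)) * (3 * εk) * Λb.card := by positivity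
  calc 1 / gk * B₃ * m * Real.exp (-(τ * D)) * (3 * εk) * Λb.card
      = 1 / gk * B₃ * m * (Real.exp (-(τ * D)) * (3 * εk) * Λb.card) := by ring
    _ ≤ 1 / gk * B₃ * (M₀ * A₀ * p₀g) * (Real.exp (-(τ * D)) * (3 * εk) * Λb.card) :=
        mul_le_mul_of_nonneg_right (mul_le_mul_of_nonneg_left hmle hpre) hrest
    _ = 1 / gk * B₃ * (M₀ * A₀ * p₀g) * Real.exp (-(τ * D)) * (3 * εk) * Λb.card := by ring

/-- **(1.6) p. 357 FROM [15] (190)** — r13's typed leaf `B16Sect1Wilson.Ineq16 T B₃ M₀ A₀ p₀g R_k M` (`|T| < 3B₃M₀A₀²p₀²(g_k)e^{−R_k}(100M)⁴`)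
for THE LINEAR TERM `T = g_k⁻¹⟨D𝐇_{1,k}B′, (1 − ζ₀)η⁻²Im ∂U₀⟩` of (1.5), DERIVED from: (190) for `B′ ↦ D𝐇_{1,k}B′` into the plaquette sup
size, one row sum (2.61) at rate `σ` (symmetric distance), `τ ≥ 0`, `σ + τ ≤ ⅛δ₀`; `B′` carried by the blocks `Λb` with B-size `< M₀A₀p₀(g_k)`
STRICTLY (the χ of (1.2) / (1.101) [IV]); `q = (1 − ζ₀)η⁻²Im ∂U₀` carried by the blocks `S` with `|q| ≤ 3ε_k` ((1.80) [IV]); the localisation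
`D ≤ d(S, Λb)` with `R_k ≤ τD` (print: `δ dist(Ω_k, Λ) ≥ R_k`, (2.2)–(2.4) [III]); `ε_k = g_kA₀p₀(g_k)` ((2.2) [III]); `#Λb ≤ (100M)⁴` (*«Λ is
contained in a cube of the size 100M»*); the weight letter `ω·(Cκ_Bc) ≤ B₃`; positivity of print's constants.
[cite: Balaban1989LargeFieldII, (1.6) p.357; Balaban1985Variational, (190) p.308; Balaban1988Convergent, (2.2) p.255] -/
theorem ineq16_of_ineq190 {bB : BlockNorm g FB} {T : FB →ₗ[ℝ] (Pl → V)} {C δ₀ σ τ c m D ω B₃ M₀ A₀ p₀g εk gk Rk M : ℝ}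
    (h190 : Ineq190 bB (supSize g box blk : BlockNorm g (Pl → V)) T C δ₀) (hC : 0 ≤ C)
    (hd : ∀ a b : g.Site, 0 ≤ g.dist a b) (hsymm : ∀ a b : g.Site, g.dist a b = g.dist b a)
    (hrow : RowSum g σ c) (hτ : 0 ≤ τ) (hστ : σ + τ ≤ δ₀ / 8)
    (B' : FB) (Λb S : Finset g.Site) (hm : ∀ y', bB.loc y' B' ≤ m) (hmlt : m < M₀ * A₀ * p₀g)
    (hsupp : ∀ y', y' ∉ Λb → bB.loc y' B' = 0) (hD : ∀ y ∈ S, ∀ y' ∈ Λb, D ≤ g.dist y y')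
    (hbox : ∀ p : Pl, p ∈ box (blk p)) (w : Pl → ℝ) (hw : ∀ p, 0 ≤ w p) (hω0 : 0 ≤ ω)
    (hω : ∀ y : g.Site, ∑ p ∈ Finset.univ.filter (fun p => blk p = y), w p ≤ ω)
    (q : Pl → V) (hqG : ∀ p, ‖q p‖ ≤ 3 * εk) (hqS : ∀ p, blk p ∉ S → q p = 0)
    (hCB : ω * (C * bB.κ * c) ≤ B₃) (hB₃ : 0 < B₃) (hM₀ : 0 < M₀) (hA₀ : 0 < A₀) (hp₀ : 0 < p₀g) (hgk : 0 < gk)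
    (hε : εk = gk * A₀ * p₀g) (hRD : Rk ≤ τ * D) (hM : 0 < M) (hvol : (Λb.card : ℝ) ≤ (100 * M) ^ 4) :
    Ineq16 (1 / gk * ∑ p, w p * ⟪T B' p, q p⟫) B₃ M₀ A₀ p₀g Rk M := by
  unfold Ineq16
  have hεk : 0 < εk := by rw [hε]; positivity
  have hmid := pairing16_le h190 hC hd hsymm hrow hτ hστ B' Λb S hm hsupp hD hbox w hw hω0 hω q hεk.le hqG hqS hCB hgk
  have hgk' : 0 < 1 / gk := by positivity
  have hE : Real.exp (-(τ * D)) ≤ Real.exp (-Rk) := Real.exp_le_exp.mpr (by linarith)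
  have hrhs : 0 < 3 * B₃ * M₀ * A₀ ^ 2 * p₀g ^ 2 * Real.exp (-Rk) * (100 * M) ^ 4 := by positivity
  -- print's second step (`ineq16_arith`): `e^{−τD} ≤ e^{−R_k}`, `#Λb ≤ (100M)⁴`, `ε_k = g_kA₀p₀(g_k)`; strict because `m < M₀A₀p₀(g_k)`
  rcases Λb.eq_empty_or_nonempty with hΛ | ⟨y₀, -⟩
  · subst hΛ
    have h0 : |1 / gk * ∑ p, w p * ⟪T B' p, q p⟫| ≤ 0 := by simpa using hmid
    linarith
  · have hm0 : 0 ≤ m := (bB.loc_nonneg y₀ B').trans (hm y₀)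
    have hY : 0 < Real.exp (-Rk) * ((3 * εk) * (100 * M) ^ 4) := by positivity
    have h2 : 1 / gk * B₃ * m * Real.exp (-(τ * D)) * (3 * εk) * Λb.card ≤
        1 / gk * B₃ * m * (Real.exp (-Rk) * ((3 * εk) * (100 * M) ^ 4)) := by
      have hin : Real.exp (-(τ * D)) * ((3 * εk) * Λb.card) ≤ Real.exp (-Rk) * ((3 * εk) * (100 * M) ^ 4) :=
        mul_le_mul hE (mul_le_mul_of_nonneg_left hvol (by positivity)) (by positivity) (Real.exp_nonneg _)
      have hpre : 0 ≤ 1 / gk * B₃ * m := by positivity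
      calc 1 / gk * B₃ * m * Real.exp (-(τ * D)) * (3 * εk) * Λb.card
          = 1 / gk * B₃ * m * (Real.exp (-(τ * D)) * ((3 * εk) * Λb.card)) := by ring
        _ ≤ 1 / gk * B₃ * m * (Real.exp (-Rk) * ((3 * εk) * (100 * M) ^ 4)) := mul_le_mul_of_nonneg_left hin hpre
    have h3 : 1 / gk * B₃ * m * (Real.exp (-Rk) * ((3 * εk) * (100 * M) ^ 4)) <
        1 / gk * B₃ * (M₀ * A₀ * p₀g) * (Real.exp (-Rk) * ((3 * εk) * (100 * M) ^ 4)) :=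
      mul_lt_mul_of_pos_right (mul_lt_mul_of_pos_left hmlt (by positivity)) hY
    have h4 : 1 / gk * B₃ * (M₀ * A₀ * p₀g) * (Real.exp (-Rk) * ((3 * εk) * (100 * M) ^ 4)) =
        3 * B₃ * M₀ * A₀ ^ 2 * p₀g ^ 2 * Real.exp (-Rk) * (100 * M) ^ 4 := by
      rw [hε]
      field_simp
    linarith [hmid, h2, h3, h4]

end Ineq16

end Literature.MathematicalPhysics.QuantumFieldTheory.Balaban1983to89.B16Ineq16From190
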